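import Summits.CriticalPhenomena.PercolationContinuityZ3.Theorems.PercNearOneGluingAdditiveGluingBlockPockets
import HarnessLib

/-! # Crux `PercNearOneGluing.AdditiveGluing` (stmt-CriticalPhenomena-4576), stub `stub_goodStep` — percolation with a vertex set killed

Support file (stub-plan prover; STUB-PLAN-stub_goodStep.md §2 H1 `pocket_exchange`, Lemma Ω: "on `{K_S = W}` the outside is
`u − W`-percolation").  Lands `--supports stmt-CriticalPhenomena-4576`; no definitions, no named facts.

`u − W` ("`W` killed") is the explicit weighting `fun e => if ∃ x ∈ W, x ∈ e then 0 else u e` of the plan (`killSet`): every pair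
meeting `W` gets weight `0`, so the vertices of `W` are almost surely isolated.  `μ_K = prodBernoulli (u − W)`, `μ = prodBernoulli u`.
* `killSet_ae_closed`: `μ_K`-a.s. no open pair meets `W`; `pathIn_avoid_of_closed`: then every open path from a vertex outside `W`
  stays outside `W`;
* `killSet_real_openConn_eq` (`μ_K(a ↔ y) = μ_K(a ↔ y in Wᶜ)`), `killSet_real_openConnIn_eq`
  (`μ_K(a ↔ y in Cᶜ) = μ_K(a ↔ y in (W ∪ C)ᶜ)`), `killSet_real_pocket_eq` (`μ_K{C(u₁) = C} = μ_K{∀ x, x ∈ C ↔ u₁ ↔ x in Wᶜ}`), for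
  vertices `a, u₁ ∉ W`;
* `killSet_real_eq_of_determinedBy`: `μ_K(E) = μ(E)` for events determined by the pairs avoiding `W`, and
  `determinedBy_pocketIn`: `{∀ x, x ∈ C ↔ u₁ ↔ x in Wᶜ}` is such an event.
[folklore; Grimmett 1999 §1.3; Kozma–Nitzan arXiv:2401.12397 §3.2 (proof of Thm 5, p. 14)]
-/

namespace Summit.CriticalPhenomena.PercolationContinuityZ3.Theorems

open MeasureTheory Set Filter
open Literature.Probability.LatticeModels (prodBernoulli)
open Literature.Probability.Percolation (BondConfig openConn openConnIn openGraph openCluster)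
open scoped BigOperators

noncomputable section
open Classical

section KillSetTransfer

open Literature.Probability.LatticeModels Literature.Probability.Percolation

variable {n : ℕ}

/-- Under `u − W`, almost surely no open pair meets `W`. [folklore] -/
theorem killSet_ae_closed (u : Sym2 (Fin n) → unitInterval) (W : Finset (Fin n)) :
    ∀ᵐ ω ∂prodBernoulli (fun e : Sym2 (Fin n) => if ∃ x ∈ W, x ∈ e then (0 : unitInterval) else u e),
      ∀ e ∈ ω, ¬ ∃ x ∈ W, x ∈ e := by
  have h : ∀ᵐ ω ∂prodBernoulli (fun e : Sym2 (Fin n) => if ∃ x ∈ W, x ∈ e then (0 : unitInterval) else u e),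
      ∀ e : Sym2 (Fin n), (∃ x ∈ W, x ∈ e) → e ∉ ω := by
    refine ae_all_iff.2 fun e => ?_
    by_cases he : ∃ x ∈ W, x ∈ e
    · filter_upwards [prodBernoulli_ae_notMem (fun e : Sym2 (Fin n) =>
        if ∃ x ∈ W, x ∈ e then (0 : unitInterval) else u e) (i := e) (by rw [if_pos he])] with ω hω
      exact fun _ => hω
    · exact Eventually.of_forall fun ω h' => absurd h' he
  filter_upwards [h] with ω hω
  exact fun e he hx => hω e hx he

/-- If no open pair meets `W`, an open path inside `T` from a vertex outside `W` stays outside `W`. [folklore] -/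
theorem pathIn_avoid_of_closed {ω : BondConfig (Fin n)} {W : Finset (Fin n)} (hω : ∀ e ∈ ω, ¬ ∃ x ∈ W, x ∈ e)
    {T : Set (Fin n)} {a y : Fin n} (h : PathIn (openGraph ω) T a y) (ha : a ∉ W) :
    PathIn (openGraph ω) (T ∩ ((W : Set (Fin n))ᶜ : Set (Fin n))) a y := by
  obtain ⟨haT, hr⟩ := h
  refine ⟨⟨haT, fun h' => ha (Finset.mem_coe.1 h')⟩, ?_⟩
  induction hr with
  | refl => exact Relation.ReflTransGen.refl
  | @tail b c _ hbc ih =>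
    refine ih.tail ⟨hbc.1, hbc.2, fun hcW => ?_⟩
    have hadj := (openGraph_adj ω b c).1 hbc.1
    exact hω _ hadj.1 ⟨c, Finset.mem_coe.1 hcW, Sym2.mem_mk_right b c⟩

/-- If no open pair meets `W`, a vertex `a ∉ W` reaches `y` iff it reaches `y` inside `Wᶜ`. [folklore] -/
theorem openConnIn_of_reachable_of_closed {ω : BondConfig (Fin n)} {W : Finset (Fin n)}
    (hω : ∀ e ∈ ω, ¬ ∃ x ∈ W, x ∈ e) {a y : Fin n} (ha : a ∉ W) (h : (openGraph ω).Reachable a y) :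
    ω ∈ openConnIn ((W : Set (Fin n))ᶜ) a y := by
  have hp := pathIn_avoid_of_closed hω (DCT16.pathIn_univ_of_reachable h) ha
  rw [Set.univ_inter] at hp
  exact DCT16.mem_openConnIn_of_pathIn hp

/-- `{x ↔ y in T} ⊆ {x ↔ y}`. [folklore] -/
theorem reachable_of_mem_openConnIn {ω : BondConfig (Fin n)} {T : Set (Fin n)} {x y : Fin n}
    (h : ω ∈ openConnIn T x y) : (openGraph ω).Reachable x y :=
  DCT16.reachable_of_pathIn (DCT16.pathIn_of_mem_openConnIn h)

/-- **`μ_{u−W}(a ↔ y) = μ_{u−W}(a ↔ y in Wᶜ)`** for `a ∉ W`. [folklore] -/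
theorem killSet_real_openConn_eq (u : Sym2 (Fin n) → unitInterval) (W : Finset (Fin n)) (a y : Fin n)
    (ha : a ∉ W) :
    (prodBernoulli (fun e : Sym2 (Fin n) => if ∃ x ∈ W, x ∈ e then (0 : unitInterval) else u e)).real
        (openConn a y) =
      (prodBernoulli (fun e : Sym2 (Fin n) => if ∃ x ∈ W, x ∈ e then (0 : unitInterval) else u e)).real
        (openConnIn ((W : Set (Fin n))ᶜ) a y) := by
  refine measureReal_congr ?_
  filter_upwards [killSet_ae_closed u W] with ω hω
  exact propext ⟨fun h => openConnIn_of_reachable_of_closed hω ha h, fun h => reachable_of_mem_openConnIn h⟩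

/-- **`μ_{u−W}(a ↔ y in Cᶜ) = μ_{u−W}(a ↔ y in (W ∪ C)ᶜ)`** for `a ∉ W`. [folklore] -/
theorem killSet_real_openConnIn_eq (u : Sym2 (Fin n) → unitInterval) (W C : Finset (Fin n)) (a y : Fin n)
    (ha : a ∉ W) :
    (prodBernoulli (fun e : Sym2 (Fin n) => if ∃ x ∈ W, x ∈ e then (0 : unitInterval) else u e)).real
        (openConnIn ((C : Set (Fin n))ᶜ) a y) =
      (prodBernoulli (fun e : Sym2 (Fin n) => if ∃ x ∈ W, x ∈ e then (0 : unitInterval) else u e)).real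
        (openConnIn ((↑(W ∪ C) : Set (Fin n))ᶜ) a y) := by
  refine measureReal_congr ?_
  filter_upwards [killSet_ae_closed u W] with ω hω
  refine propext ⟨fun h => ?_, fun h => goodStep24_openConnIn_mono (fun v hv => ?_) a y h⟩
  · have hp := pathIn_avoid_of_closed hω (DCT16.pathIn_of_mem_openConnIn h) ha
    have hset : ((C : Set (Fin n))ᶜ ∩ ((W : Set (Fin n))ᶜ : Set (Fin n))) = ((↑(W ∪ C) : Set (Fin n))ᶜ) := by
      rw [Finset.coe_union, Set.compl_union, Set.inter_comm]
    rw [hset] at hp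
    exact DCT16.mem_openConnIn_of_pathIn hp
  · rw [Finset.coe_union, Set.compl_union] at hv
    exact hv.2

/-- **`μ_{u−W}{∀ x, x ∈ C ↔ u₁ ↔ x} = μ_{u−W}{∀ x, x ∈ C ↔ u₁ ↔ x in Wᶜ}`** for `u₁ ∉ W` (the pocket of `u₁` read inside `Wᶜ`). [folklore] -/
theorem killSet_real_pocket_eq (u : Sym2 (Fin n) → unitInterval) (W C : Finset (Fin n)) (u₁ : Fin n)
    (hu₁ : u₁ ∉ W) :
    (prodBernoulli (fun e : Sym2 (Fin n) => if ∃ x ∈ W, x ∈ e then (0 : unitInterval) else u e)).real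
        {ω : BondConfig (Fin n) | ∀ x : Fin n, (x ∈ C ↔ ω ∈ openConn u₁ x)} =
      (prodBernoulli (fun e : Sym2 (Fin n) => if ∃ x ∈ W, x ∈ e then (0 : unitInterval) else u e)).real
        {ω : BondConfig (Fin n) | ∀ x : Fin n, (x ∈ C ↔ ω ∈ openConnIn ((W : Set (Fin n))ᶜ) u₁ x)} := by
  refine measureReal_congr ?_
  filter_upwards [killSet_ae_closed u W] with ω hω
  refine propext (forall_congr' fun x => iff_congr Iff.rfl ⟨fun h => ?_, fun h => ?_⟩)
  · exact openConnIn_of_reachable_of_closed hω hu₁ h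
  · exact reachable_of_mem_openConnIn h

/-- `u − W` agrees with `u` on the pairs avoiding `W`, so both give the same mass to events determined by those pairs. [folklore] -/
theorem killSet_real_eq_of_determinedBy (u : Sym2 (Fin n) → unitInterval) (W : Finset (Fin n))
    (E : Set (BondConfig (Fin n)))
    (hE : DeterminedBy E (↑(Finset.univ.filter fun e : Sym2 (Fin n) => ∀ v ∈ e, v ∉ W) : Set (Sym2 (Fin n)))) :
    (prodBernoulli (fun e : Sym2 (Fin n) => if ∃ x ∈ W, x ∈ e then (0 : unitInterval) else u e)).real E =
      (prodBernoulli u).real E := by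
  refine prodBernoulli_real_eq_of_determinedBy _ u (fun e he => ?_) hE MeasurableSet.of_discrete
  have he' : ∀ v ∈ e, v ∉ W := (Finset.mem_filter.1 (Finset.mem_coe.1 he)).2
  have : ¬ ∃ x ∈ W, x ∈ e := fun ⟨x, hxW, hxe⟩ => he' x hxe hxW
  simp only [this, if_false]

/-- `{∀ x, x ∈ C ↔ u₁ ↔ x in Wᶜ}` is determined by the pairs avoiding `W`. [folklore] -/
theorem determinedBy_pocketIn (W C : Finset (Fin n)) (u₁ : Fin n) :
    DeterminedBy {ω : BondConfig (Fin n) | ∀ x : Fin n, (x ∈ C ↔ ω ∈ openConnIn ((W : Set (Fin n))ᶜ) u₁ x)}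
      (↑(Finset.univ.filter fun e : Sym2 (Fin n) => ∀ v ∈ e, v ∉ W) : Set (Sym2 (Fin n))) := by
  rw [determinedBy_iff]
  intro ω ω' hag
  simp only [Set.mem_setOf_eq]
  refine forall_congr' fun x => iff_congr Iff.rfl ?_
  exact (determinedBy_iff _ _).1 (offObs_determinedBy_openConnIn_compl W u₁ x) ω ω' hag

/-- The two transfers combined for a two-point function: `μ_{u−W}(a ↔ y) = μ_u(a ↔ y in Wᶜ)` for `a ∉ W`. [folklore] -/
theorem killSet_real_openConn_eq_offConn (u : Sym2 (Fin n) → unitInterval) (W : Finset (Fin n)) (a y : Fin n)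
    (ha : a ∉ W) :
    (prodBernoulli (fun e : Sym2 (Fin n) => if ∃ x ∈ W, x ∈ e then (0 : unitInterval) else u e)).real
        (openConn a y) = (prodBernoulli u).real (openConnIn ((W : Set (Fin n))ᶜ) a y) := by
  rw [killSet_real_openConn_eq u W a y ha,
    killSet_real_eq_of_determinedBy u W _ (offObs_determinedBy_openConnIn_compl W a y)]

end KillSetTransfer

open Literature.Probability.LatticeModels Literature.Probability.Percolation in
/-- Registered helper stub `stub_killSetOffConn_sp` (stub-plan prover): the two-point function of the graph with the vertex
set `W` killed is the `W`-avoiding connection probability of the original graph, `μ_{u−W}(a ↔ y) = μ_u(a ↔ y in Wᶜ)` for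
`a ∉ W` (= `killSet_real_openConn_eq_offConn`). [folklore] -/
theorem stub_killSetOffConn_sp : ∀ (n : ℕ) (u : Sym2 (Fin n) → unitInterval) (W : Finset (Fin n)) (a y : Fin n), a ∉ W → (prodBernoulli (fun e : Sym2 (Fin n) => if ∃ x ∈ W, x ∈ e then (0 : unitInterval) else u e)).real (openConn a y) = (prodBernoulli u).real (openConnIn ((W : Set (Fin n))ᶜ) a y) :=
  fun _ u W a y ha => killSet_real_openConn_eq_offConn u W a y ha

end

end Summit.CriticalPhenomena.PercolationContinuityZ3.Theorems
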